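import Mathlib

/-!
# Route BarrierLever — item `PartitionMinorsHitByVP` (stmt-ValiantsHypothesis-19717), line `hidden_states`:
# THE SHADOW-RANK BOUND, part 1 — the averaged expansion of one entry

Helper file (`--supports stmt-ValiantsHypothesis-19717`; cell valiant-natproofs, rung V4, 𝒟-side door (c), line
`hidden_states`, node #1 `stub_universalJoinWide`; prover seat val-np-p3 gen 19). Definition-free apart from bookkeeping
`def`s (assignment slots, parts, the averaged coefficient). Closes NO item; it is the entry expansion behind the
every-level SHADOW-RANK BOUND of `…HiddenStatesShadowRank` (the every-`t` form of `…TripleRank` / `…FiveRank`; memo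
HOME/val-np-p3/g19/MEMO-hybrid-valnp3-g19.md §7c).

THE EXPANSION (`prod_eq_sum_coef`). One table `y : Option (Fin K) → Fin h → ℂ` (`none` = the constant), a row `U ⊆ T`
with `|U| ≤ s`, a column `J` with `|J| = t`, and `q` with `s < t (q+1)` (`q ≥ ⌊s/t⌋`). Expanding
`∏_{a ∈ U} (y none a + Σ_{p ∈ J} y (some p) a)` over assignments `f : U → J ⊔ {none}` (`prod_eq_sum_assignments`), SOME
state `p ∈ J` receives a part `f⁻¹(p)` of size `≤ q` (pigeonhole, `smallParts_nonempty`); averaging over all such `p`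
with weight `1/#{p ∈ J : |f⁻¹ p| ≤ q}` (`prod_eq_sum_weights`) and collecting the assignments with `f⁻¹(p) = V`
(`sum_fiber_eq`, a bijection with the assignments of `U ∖ V` to `(J ∖ p) ⊔ {none}`) gives

  `∏_{a ∈ U} (y none a + Σ_{p ∈ J} y (some p) a) = Σ_{p ∈ J} Σ_{V ⊆ T, |V| ≤ q} coef q y U (J ∖ p) V · ∏_{a ∈ V} y (some p) a`

with `coef` depending on the row, the `(t−1)`-set `J ∖ p` and the monomial `V` only — NOT on `p`. Part 2 turns this
into the rank bound `#{off-level columns} + |(t−1)-shadow| · #{V ⊆ T : |V| ≤ q}` for joins.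
WHAT THIS IS NOT: nothing on crux 14610 or VP ≠ VNP.
-/

set_option linter.dupNamespace false

namespace Summit.ValiantsHypothesis.ValiantsHypothesis.Theorems.BarrierLever.HiddenStates

open Finset

noncomputable section

namespace ShadowRank

variable {K h : ℕ}

/-! ## Assignments, parts and the coefficient -/

/-- Allowed values of an assignment at coordinate `a`: a state of `J` or `none` on `U`, forced `none` off `U`. -/
def slots (U : Finset (Fin h)) (J : Finset (Fin K)) (a : Fin h) : Finset (Option (Fin K)) :=
  if a ∈ U then insertNone J else {none}

/-- The part of the assignment `f` sent to the state `p`. -/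
def part (f : Fin h → Option (Fin K)) (p : Fin K) : Finset (Fin h) := univ.filter fun a => f a = some p

/-- The states of `T'` whose part under `f` has size `≤ q`. -/
def smallParts (q : ℕ) (T' : Finset (Fin K)) (f : Fin h → Option (Fin K)) : Finset (Fin K) :=
  T'.filter fun p => (part f p).card ≤ q

/-- The coefficient of the row `U` on the column-function `(T', V)` for the table `y` (weight-averaged over the
assignments of `U ∖ V` to `T' ⊔ {none}`). -/
def coef (q : ℕ) (y : Option (Fin K) → Fin h → ℂ) (U : Finset (Fin h)) (T' : Finset (Fin K))
    (V : Finset (Fin h)) : ℂ :=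
  if V ⊆ U then
    ∑ f ∈ Fintype.piFinset (slots (U \ V) T'), (((smallParts q T' f).card : ℂ) + 1)⁻¹ * ∏ a ∈ U \ V, y (f a) a
  else 0

/-- Membership in a part. -/
theorem mem_part {f : Fin h → Option (Fin K)} {p : Fin K} {a : Fin h} : a ∈ part f p ↔ f a = some p := by
  simp [part]

/-- The slots at a coordinate of `U`. -/
theorem slots_of_mem {U : Finset (Fin h)} {J : Finset (Fin K)} {a : Fin h} (ha : a ∈ U) :
    slots U J a = insertNone J := by simp [slots, ha]

/-- The slots off `U`. -/
theorem slots_of_not_mem {U : Finset (Fin h)} {J : Finset (Fin K)} {a : Fin h} (ha : a ∉ U) :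
    slots U J a = {none} := by simp [slots, ha]

/-- An assignment is `none` off `U`. -/
theorem eq_none_of_not_mem {U : Finset (Fin h)} {J : Finset (Fin K)} {f : Fin h → Option (Fin K)}
    (hf : f ∈ Fintype.piFinset (slots U J)) {a : Fin h} (ha : a ∉ U) : f a = none := by
  have := Fintype.mem_piFinset.mp hf a
  rwa [slots_of_not_mem ha, Finset.mem_singleton] at this

/-- A state hit by an assignment lies in `J`, at a coordinate of `U`. -/
theorem mem_of_eq_some {U : Finset (Fin h)} {J : Finset (Fin K)} {f : Fin h → Option (Fin K)}
    (hf : f ∈ Fintype.piFinset (slots U J)) {a : Fin h} {p : Fin K} (hap : f a = some p) : a ∈ U ∧ p ∈ J := by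
  have ha : a ∈ U := by
    by_contra haU
    rw [eq_none_of_not_mem hf haU] at hap
    exact (Option.some_ne_none p) hap.symm
  have := Fintype.mem_piFinset.mp hf a
  rw [slots_of_mem ha, hap] at this
  exact ⟨ha, Finset.some_mem_insertNone.mp this⟩

/-- Parts lie inside `U`. -/
theorem part_subset {U : Finset (Fin h)} {J : Finset (Fin K)} {f : Fin h → Option (Fin K)}
    (hf : f ∈ Fintype.piFinset (slots U J)) (p : Fin K) : part f p ⊆ U :=
  fun _ ha => (mem_of_eq_some hf (mem_part.mp ha)).1

/-- **Pigeonhole.** If `|U| ≤ s < t (q+1)` and `|J| = t`, some state of `J` has a part of size `≤ q`. -/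
theorem smallParts_nonempty {q s t : ℕ} (hst : s < t * (q + 1)) {U : Finset (Fin h)} (hUs : U.card ≤ s)
    {J : Finset (Fin K)} (hJ : J.card = t) {f : Fin h → Option (Fin K)}
    (hf : f ∈ Fintype.piFinset (slots U J)) : (smallParts q J f).Nonempty := by
  by_contra hP
  rw [Finset.not_nonempty_iff_eq_empty] at hP
  have hbig : ∀ p ∈ J, q + 1 ≤ (part f p).card := by
    intro p hp
    by_contra hlt
    have hmem : p ∈ smallParts q J f := Finset.mem_filter.mpr ⟨hp, by omega⟩
    rw [hP] at hmem
    simp at hmem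
  have hdisj : ∀ p ∈ J, ∀ p' ∈ J, p ≠ p' → Disjoint (part f p) (part f p') := by
    intro p _ p' _ hpp'
    rw [Finset.disjoint_left]
    intro a ha ha'
    exact hpp' (Option.some_injective _ ((mem_part.mp ha).symm.trans (mem_part.mp ha')))
  have hsub : J.biUnion (part f) ⊆ U := by
    intro a ha
    obtain ⟨p, _, hap⟩ := Finset.mem_biUnion.mp ha
    exact part_subset hf p hap
  have hcard : ∑ p ∈ J, (part f p).card ≤ U.card := by
    rw [← Finset.card_biUnion hdisj]
    exact Finset.card_le_card hsub
  have hge : t * (q + 1) ≤ ∑ p ∈ J, (part f p).card := by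
    calc t * (q + 1) = ∑ _p ∈ J, (q + 1) := by rw [Finset.sum_const, smul_eq_mul, hJ]
      _ ≤ ∑ p ∈ J, (part f p).card := Finset.sum_le_sum hbig
  omega

/-! ## The expansion of one entry -/

/-- Step (a): the entry as a sum over assignments. -/
theorem prod_eq_sum_assignments (y : Option (Fin K) → Fin h → ℂ) (U : Finset (Fin h)) (J : Finset (Fin K)) :
    ∏ a ∈ U, (y none a + ∑ p ∈ J, y (some p) a) =
      ∑ f ∈ Fintype.piFinset (slots U J), ∏ a ∈ U, y (f a) a := by
  classical
  have h1 : ∏ a ∈ U, (y none a + ∑ p ∈ J, y (some p) a) =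
      ∏ a, ∑ o ∈ slots U J a, (if a ∈ U then y o a else 1) := by
    rw [← Finset.prod_mul_prod_compl U (fun a => ∑ o ∈ slots U J a, (if a ∈ U then y o a else (1 : ℂ)))]
    have hc : ∏ a ∈ Uᶜ, ∑ o ∈ slots U J a, (if a ∈ U then y o a else (1 : ℂ)) = 1 := by
      refine Finset.prod_eq_one fun a ha => ?_
      have ha' : a ∉ U := Finset.mem_compl.mp ha
      simp [slots_of_not_mem ha', ha']
    rw [hc, mul_one]
    refine Finset.prod_congr rfl fun a ha => ?_
    rw [slots_of_mem ha, Finset.sum_insertNone]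
    simp [ha]
  rw [h1, Finset.prod_univ_sum]
  refine Finset.sum_congr rfl fun f _ => ?_
  rw [← Finset.prod_mul_prod_compl U (fun a => if a ∈ U then y (f a) a else (1 : ℂ))]
  have hc : ∏ a ∈ Uᶜ, (if a ∈ U then y (f a) a else (1 : ℂ)) = 1 :=
    Finset.prod_eq_one fun a ha => by simp [Finset.mem_compl.mp ha]
  rw [hc, mul_one]
  exact Finset.prod_congr rfl fun a ha => by simp [ha]

/-- Step (b): insert the averaging weights `1/#smallParts` (each assignment is counted once in total). -/
theorem prod_eq_sum_weights {q s t : ℕ} (hst : s < t * (q + 1)) (y : Option (Fin K) → Fin h → ℂ)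
    {U : Finset (Fin h)} (hUs : U.card ≤ s) {J : Finset (Fin K)} (hJ : J.card = t)
    {f : Fin h → Option (Fin K)} (hf : f ∈ Fintype.piFinset (slots U J)) :
    ∏ a ∈ U, y (f a) a =
      ∑ p ∈ J, (if (part f p).card ≤ q then
        (((smallParts q J f).card : ℂ))⁻¹ * ∏ a ∈ U, y (f a) a else 0) := by
  rw [← Finset.sum_filter]
  change ∏ a ∈ U, y (f a) a = ∑ _p ∈ smallParts q J f, (((smallParts q J f).card : ℂ))⁻¹ * ∏ a ∈ U, y (f a) a
  rw [Finset.sum_const, nsmul_eq_mul, ← mul_assoc, mul_inv_cancel₀, one_mul]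
  exact_mod_cast (Finset.card_pos.mpr (smallParts_nonempty hst hUs hJ hf)).ne'

/-- Step (d): the fibre of assignments with `f⁻¹(p) = V` is the coefficient times `∏_{a ∈ V} y (some p) a`. -/
theorem sum_fiber_eq (q : ℕ) (y : Option (Fin K) → Fin h → ℂ) (U : Finset (Fin h)) {J : Finset (Fin K)}
    {p : Fin K} (hp : p ∈ J) {V : Finset (Fin h)} (hVq : V.card ≤ q) :
    ∑ f ∈ (Fintype.piFinset (slots U J)).filter (fun f => part f p = V),
        (if (part f p).card ≤ q then (((smallParts q J f).card : ℂ))⁻¹ * ∏ a ∈ U, y (f a) a else 0) =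
      coef q y U (J.erase p) V * ∏ a ∈ V, y (some p) a := by
  classical
  -- simplify the `if` on the fibre
  have hif : ∀ f ∈ (Fintype.piFinset (slots U J)).filter (fun f => part f p = V),
      (if (part f p).card ≤ q then (((smallParts q J f).card : ℂ))⁻¹ * ∏ a ∈ U, y (f a) a else 0) =
        (((smallParts q J f).card : ℂ))⁻¹ * ∏ a ∈ U, y (f a) a := by
    intro f hf
    rw [(Finset.mem_filter.mp hf).2, if_pos hVq]
  rw [Finset.sum_congr rfl hif]
  by_cases hVU : V ⊆ U
  swap
  · -- empty fibre
    rw [coef, if_neg hVU, zero_mul]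
    refine Finset.sum_eq_zero fun f hf => ?_
    obtain ⟨hf, hfV⟩ := Finset.mem_filter.mp hf
    exact absurd (hfV ▸ part_subset hf p) hVU
  rw [coef, if_pos hVU, Finset.sum_mul]
  -- the bijection `f ↦ f'` (forget the part `V`), inverse `f' ↦ f` (send `V` to `p`)
  refine Finset.sum_nbij' (fun f a => if a ∈ V then none else f a)
    (fun f' a => if a ∈ V then some p else f' a) ?_ ?_ ?_ ?_ ?_
  · -- maps into the smaller assignment set
    intro f hf
    obtain ⟨hf, hfV⟩ := Finset.mem_filter.mp (Finset.mem_coe.mp hf)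
    refine Finset.mem_coe.mpr (Fintype.mem_piFinset.mpr fun a => ?_)
    by_cases haV : a ∈ V
    · have : a ∉ U \ V := fun h' => (Finset.mem_sdiff.mp h').2 haV
      simp [haV, slots_of_not_mem this]
    · simp only [haV, if_false]
      by_cases haU : a ∈ U
      · rw [slots_of_mem (Finset.mem_sdiff.mpr ⟨haU, haV⟩)]
        rcases hfa : f a with _ | p'
        · exact Finset.none_mem_insertNone
        · refine Finset.some_mem_insertNone.mpr (Finset.mem_erase.mpr ⟨?_, (mem_of_eq_some hf hfa).2⟩)
          rintro rfl
          exact haV (hfV ▸ mem_part.mpr hfa)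
      · have : a ∉ U \ V := fun h' => haU (Finset.mem_sdiff.mp h').1
        rw [slots_of_not_mem this, Finset.mem_singleton]
        exact eq_none_of_not_mem hf haU
  · -- the inverse maps into the fibre
    intro f' hf'
    have hf' := Fintype.mem_piFinset.mp (Finset.mem_coe.mp hf')
    refine Finset.mem_coe.mpr (Finset.mem_filter.mpr ⟨Fintype.mem_piFinset.mpr fun a => ?_, ?_⟩)
    · by_cases haV : a ∈ V
      · simp only [haV, if_true, slots_of_mem (hVU haV)]
        exact Finset.some_mem_insertNone.mpr hp
      · simp only [haV, if_false]
        by_cases haU : a ∈ U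
        · have := hf' a
          rw [slots_of_mem (Finset.mem_sdiff.mpr ⟨haU, haV⟩)] at this
          rw [slots_of_mem haU]
          revert this
          rcases f' a with _ | p' <;> intro this
          · exact Finset.none_mem_insertNone
          · exact Finset.some_mem_insertNone.mpr (Finset.mem_of_mem_erase (Finset.some_mem_insertNone.mp this))
        · have hne : a ∉ U \ V := fun h' => haU (Finset.mem_sdiff.mp h').1
          have := hf' a
          rw [slots_of_not_mem hne, Finset.mem_singleton] at this
          rw [slots_of_not_mem haU, this, Finset.mem_singleton]
    · ext a
      rw [mem_part]
      by_cases haV : a ∈ V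
      · simp [haV]
      · simp only [haV, if_false, iff_false]
        intro hfa
        by_cases haU : a ∈ U
        · have := hf' a
          rw [slots_of_mem (Finset.mem_sdiff.mpr ⟨haU, haV⟩), hfa] at this
          exact Finset.notMem_erase p J (Finset.some_mem_insertNone.mp this)
        · have hne : a ∉ U \ V := fun h' => haU (Finset.mem_sdiff.mp h').1
          have := hf' a
          rw [slots_of_not_mem hne, Finset.mem_singleton] at this
          rw [this] at hfa
          exact (Option.some_ne_none p) hfa.symm
  · -- left inverse
    intro f hf
    obtain ⟨_, hfV⟩ := Finset.mem_filter.mp (Finset.mem_coe.mp hf)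
    funext a
    by_cases haV : a ∈ V
    · simp only [haV, if_true]
      exact (mem_part.mp (hfV ▸ haV)).symm
    · simp [haV]
  · -- right inverse
    intro f' hf'
    have hf' := Fintype.mem_piFinset.mp (Finset.mem_coe.mp hf')
    funext a
    by_cases haV : a ∈ V
    · simp only [haV, if_true]
      have hne : a ∉ U \ V := fun h' => (Finset.mem_sdiff.mp h').2 haV
      have := hf' a
      rw [slots_of_not_mem hne, Finset.mem_singleton] at this
      exact this.symm
    · simp [haV]
  · -- the summands agree
    intro f hf
    obtain ⟨hf, hfV⟩ := Finset.mem_filter.mp (Finset.mem_coe.mp hf)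
    -- the weights
    have hparts : ∀ p' ∈ J.erase p, part f p' = part (fun a => if a ∈ V then none else f a) p' := by
      intro p' hp'
      ext a
      rw [mem_part, mem_part]
      by_cases haV : a ∈ V
      · simp only [haV, if_true]
        have hfa : f a = some p := mem_part.mp (hfV ▸ haV)
        rw [hfa]
        simp only [Option.some.injEq, reduceCtorEq, iff_false]
        exact fun hpp => (Finset.mem_erase.mp hp').1 hpp.symm
      · simp [haV]
    have hsmall : smallParts q J f = insert p (smallParts q (J.erase p) (fun a => if a ∈ V then none else f a)) := by
      ext p'
      simp only [smallParts, Finset.mem_filter, Finset.mem_insert, Finset.mem_erase]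
      constructor
      · rintro ⟨hp'J, hcard⟩
        by_cases hpp : p' = p
        · exact Or.inl hpp
        · refine Or.inr ⟨⟨hpp, hp'J⟩, ?_⟩
          rwa [← hparts p' (Finset.mem_erase.mpr ⟨hpp, hp'J⟩)]
      · rintro (rfl | ⟨⟨hpp, hp'J⟩, hcard⟩)
        · exact ⟨hp, by rwa [hfV]⟩
        · exact ⟨hp'J, by rwa [hparts p' (Finset.mem_erase.mpr ⟨hpp, hp'J⟩)]⟩
    have hnot : p ∉ smallParts q (J.erase p) (fun a => if a ∈ V then none else f a) := fun h' =>
      Finset.notMem_erase p J (Finset.mem_filter.mp h').1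
    have hw : ((smallParts q J f).card : ℂ) =
        ((smallParts q (J.erase p) (fun a => if a ∈ V then none else f a)).card : ℂ) + 1 := by
      rw [hsmall, Finset.card_insert_of_notMem hnot]
      push_cast
      ring
    -- the products
    have hprod : ∏ a ∈ U, y (f a) a =
        (∏ a ∈ U \ V, y ((fun a => if a ∈ V then none else f a) a) a) * ∏ a ∈ V, y (some p) a := by
      rw [← Finset.prod_sdiff hVU]
      congr 1
      · exact Finset.prod_congr rfl fun a ha => by simp [(Finset.mem_sdiff.mp ha).2]
      · exact Finset.prod_congr rfl fun a ha => by
          rw [mem_part.mp (show a ∈ part f p by rw [hfV]; exact ha)]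
    rw [hw, hprod, mul_assoc]

/-- **THE EXPANSION OF ONE ENTRY** on the column-functions `(J ∖ p, V)`, `p ∈ J`, `V ⊆ T`, `|V| ≤ q`. -/
theorem prod_eq_sum_coef {q s t : ℕ} (hst : s < t * (q + 1)) (y : Option (Fin K) → Fin h → ℂ)
    {U T : Finset (Fin h)} (hUT : U ⊆ T) (hUs : U.card ≤ s) {J : Finset (Fin K)} (hJ : J.card = t) :
    ∏ a ∈ U, (y none a + ∑ p ∈ J, y (some p) a) =
      ∑ p ∈ J, ∑ V ∈ T.powerset.filter (fun V => V.card ≤ q),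
        coef q y U (J.erase p) V * ∏ a ∈ V, y (some p) a := by
  classical
  rw [prod_eq_sum_assignments]
  rw [Finset.sum_congr rfl fun f hf => prod_eq_sum_weights hst y hUs hJ hf, Finset.sum_comm]
  refine Finset.sum_congr rfl fun p hp => ?_
  -- fibrewise over `V = part f p ∈ T.powerset`
  have hmaps : ∀ f ∈ Fintype.piFinset (slots U J), part f p ∈ T.powerset := fun f hf =>
    Finset.mem_powerset.mpr ((part_subset hf p).trans hUT)
  rw [← Finset.sum_fiberwise_of_maps_to hmaps, Finset.sum_filter]
  refine Finset.sum_congr rfl fun V _ => ?_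
  by_cases hVq : V.card ≤ q
  · rw [if_pos hVq]
    exact sum_fiber_eq q y U hp hVq
  · rw [if_neg hVq]
    refine Finset.sum_eq_zero fun f hf => ?_
    rw [(Finset.mem_filter.mp hf).2, if_neg hVq]

end ShadowRank

end

end Summit.ValiantsHypothesis.ValiantsHypothesis.Theorems.BarrierLever.HiddenStates
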